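import Literature.NumberTheory.LFunctions.SiegelTatuzawaHoffsteinTheoremOne
import Literature.NumberTheory.LFunctions.ImaginaryQuadraticClassNumberHalfLogBound
import Literature.NumberTheory.LFunctions.Zhang2022.RepairBedAssumptionAPrimitive
import HarnessLib

/-!
# Hoffstein 1980, Theorem 2 (Acta Arith. 38, p. 168) — the discharge of `hoffstein1980_theorem2`

Topic `Literature/NumberTheory/LFunctions`. Everything in this file is PROVED; its last theorem is
`Literature.NumberTheory.LFunctions.hoffstein1980_theorem2_holds : hoffstein1980_theorem2`, discharging the
named fact of `SiegelTatuzawaExplicit.lean`: J. Hoffstein, *On the Siegel–Tatuzawa theorem*, Acta Arith.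
**38** (1980) 167–174, THEOREM 2 (p. 168) in its typed form (§4 p. 173): for `0 < ε < 1/1000`, `χ′` odd real
primitive mod `q′ > ε⁻²` with (5) `L(1,χ′) < 1/(7.735 log q′)`, `h₀` the class number of the imaginary
quadratic field of discriminant `−q′`, and `χ ≠ χ′` real primitive mod `q ≥ q′`:
`min(1/(7.735 log q), ε⁻¹/(15.350 h₀ (log q)² q^{3.344 h₀ ε})) < L(1,χ)`.

We follow §4 (p. 173): (17) `L(1,χ′) = π h₀/√q′` (the analytic class number formula,
`Quadratic.LFunction_one_eq_of_discr_neg_of_eq`, `w = 2`; the given `χ′` IS the Kronecker character of the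
field: two odd primitive quadratic characters of the same modulus coincide,
`eq_of_isPrimitive_isQuadratic_odd`, from the tree's `changeLevel_kroneckerChar_eq` = Montgomery–Vaughan
Thm 9.13); Lemma 1: `1 − β′ < L(1,χ′)/1.511` (print `1.507`; `Hoffstein1980.exists_realZero_of_lOne_le`);
(18) `x^{1−β′} = (qq′)^{1.5(1−β′)} ≤ e^{1.5/11.657} q^{1.5π h₀/(1.511√q′)} ≤ 1.138 q^{3.344 h₀ ε}` (print:
`1.148 |d|^{3.344 h₀/√|d′|}`); "proceeding as in Theorem 1" = the §3 core `core3` (the three-character master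
inequality `hoffstein_master3` at `x = (qq′)^{3/2}` with its numerics, extracted from the proof of Theorem 1′:
`1.6 (1−β′) x^{−(1−β′)} ≤ L(1,χ) L(1,χ′) (½ log qq′ + 1.3)`), Lemma 3 (`1 − β′ > 1/(5.828 log qq′)` or done),
and "as we can again assume `log|d|/log|d′| > 4.63`" = Theorem 1′ (`theorem1'_of_le`) read backwards: if
`L(1,χ) ≤ 1/(7.735 log q)` then `15.47 y < (1+y)² e^{.138(1+y)}`, `y = log q/log q′`, which forces `y > 4.65`
(`lt_of_constraint`), so `log qq′ < 1.2151 log q`. Resulting constant: `10.6 < 15.350` (print: `12.624 · 1.216 =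
15.350`, where `(log|dd′|)²` would call for `1.216²` — the kernel's slack covers it), exponent `3.12 < 3.344`;
finally `√q′ > ε⁻¹` is substituted as printed ("remains true if we substitute a smaller value for `√|d′|`").

## References

* J. Hoffstein, On the Siegel–Tatuzawa theorem, Acta Arith. 38 (1980) 167–174, Theorem 2 p. 168, §4 p. 173
  ((17), (18)). [Hoffstein1980SiegelTatuzawa]
* H. L. Montgomery, R. C. Vaughan, Multiplicative Number Theory I, CUP 2007, Theorem 9.13 (primitive quadratic
  characters are the `χ_d`, `d` fundamental). [MontgomeryVaughan2007]
* J. Neukirch, Algebraic Number Theory, Springer 1999, Ch. VII §5 (5.11) (class number formula). [NeukirchANT1999]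
-/

noncomputable section

open Complex DirichletCharacter
open scoped Real

namespace Literature.NumberTheory.LFunctions.Hoffstein1980

open Literature.NumberTheory.LFunctions.Booker2006Turing
open Literature.NumberTheory.QuadraticFields Literature.NumberTheory.QuadraticFields.Quadratic

/-! ### Helpers (as in `SiegelTatuzawaHoffsteinTheoremOnePrime.lean`, private there) -/

/-- `log r > 13.1697` for `r > 10⁶` (`2¹⁹ < 10⁶`). [folklore] -/
private lemma log_gt_of_gt_ten6' {r : ℝ} (hr : 10 ^ 6 < r) : (13.1697 : ℝ) < Real.log r := by
  have h19 : Real.log ((2 : ℝ) ^ 19) < Real.log r :=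
    Real.log_lt_log (by positivity) (by linarith [show ((2 : ℝ) ^ 19) < 10 ^ 6 by norm_num])
  rw [Real.log_pow] at h19
  push_cast at h19
  linarith [Real.log_two_gt_d9]

/-- `N^{1/5} ≥ 100` for `N ≥ 10¹⁰`. [folklore] -/
private lemma rpow_fifth_ge {N : ℝ} (hN : (10 : ℝ) ^ 10 ≤ N) : (100 : ℝ) ≤ N ^ (1 / 5 : ℝ) := by
  have hN0 : 0 ≤ N := le_trans (by norm_num) hN
  have h5 : (N ^ (1 / 5 : ℝ)) ^ (5 : ℕ) = N := by
    rw [← Real.rpow_natCast, ← Real.rpow_mul hN0]; norm_num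
  have hy : 0 ≤ N ^ (1 / 5 : ℝ) := Real.rpow_nonneg hN0 _
  by_contra hlt
  push Not at hlt
  have : (N ^ (1 / 5 : ℝ)) ^ (5 : ℕ) < 100 ^ 5 := pow_lt_pow_left₀ hlt hy (by norm_num)
  rw [h5] at this
  linarith [this]

/-- For a quadratic non-trivial `χ`, `L(1, χ)` is real and positive (real part `> 0`, imaginary part `0`,
norm `=` real part). [folklore] -/
private lemma LFunction_one_re_pos' {n : ℕ} [NeZero n] {φ : DirichletCharacter ℂ n} (hφ1 : φ ≠ 1)
    (h2 : φ ^ 2 = 1) : 0 < (φ.LFunction 1).re ∧ ‖φ.LFunction 1‖ = (φ.LFunction 1).re := by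
  have him : (φ.LFunction 1).im = 0 := by
    have := DirichletAbel.LFunction_ofReal_im_eq_zero φ hφ1 h2 (σ := 1) one_pos
    simpa using this
  have hpos : 0 < (φ.LFunction 1).re := by
    have := DirichletAbel.LFunction_ofReal_re_pos_of_forall_ne_zero φ hφ1 h2 one_pos le_rfl
      fun σ h1 h2 ↦ by
        have hσ : σ = 1 := le_antisymm h2 h1
        subst hσ
        exact DirichletCharacter.LFunction_ne_zero_of_one_le_re φ (Or.inl hφ1) (by simp)
    simpa using this
  refine ⟨hpos, ?_⟩
  rw [← Complex.re_add_im (φ.LFunction 1), him]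
  simp [abs_of_pos hpos]

/-- A primitive character modulo `n > 1` is non-trivial. [folklore] -/
private lemma ne_one_of_isPrimitive₄ {n : ℕ} [NeZero n] {φ : DirichletCharacter ℂ n}
    (hφ : φ.IsPrimitive) (hn : 1 < n) : φ ≠ 1 := by
  rintro rfl
  have h : (1 : DirichletCharacter ℂ n).conductor = n := hφ
  rw [DirichletCharacter.conductor_one] at h; omega

/-- `e^{0.69} ≤ 2`. [folklore] -/
private lemma exp_069_le : Real.exp 0.69 ≤ 2 := by
  refine (Real.exp_bound' (x := 0.69) (by norm_num) (by norm_num) (n := 5) (by norm_num)).trans ?_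
  norm_num [Finset.sum_range_succ, Nat.factorial]

/-- `e^{0.7797} ≤ 2.19`. [folklore] -/
private lemma exp_07797_le : Real.exp 0.7797 ≤ 2.19 := by
  refine (Real.exp_bound' (x := 0.7797) (by norm_num) (by norm_num) (n := 6) (by norm_num)).trans ?_
  norm_num [Finset.sum_range_succ, Nat.factorial]

/-- `e^{0.1287} ≤ 1.138`. [folklore] -/
private lemma exp_01287_le : Real.exp 0.1287 ≤ 1.138 := by
  refine (Real.exp_bound' (x := 0.1287) (by norm_num) (by norm_num) (n := 3) (by norm_num)).trans ?_
  norm_num [Finset.sum_range_succ, Nat.factorial]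

/-- First half of `key_ineq` (pp. 172–173): for `1 ≤ y ≤ 4.65`, `(1+y)² e^{.138(1+y)} ≤ 15.47 y`; so the
constraint `15.47 y < (1+y)² e^{.138(1+y)}` forces `y > 4.65` (print: "we can again assume that
`log|d|/log|d′| > 4.63`"). [cite: Hoffstein1980SiegelTatuzawa, pp. 172–173] -/
theorem lt_of_constraint {y : ℝ} (hy : 1 ≤ y)
    (hC : 15.47 * y < (1 + y) ^ 2 * Real.exp (0.138 * (1 + y))) : 4.65 < y := by
  by_contra h465
  push Not at h465
  by_cases h4 : y ≤ 4
  · have hE : Real.exp (0.138 * (1 + y)) ≤ 2 :=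
      (Real.exp_le_exp.2 (by nlinarith)).trans exp_069_le
    have h' : (1 + y) ^ 2 * Real.exp (0.138 * (1 + y)) ≤ (1 + y) ^ 2 * 2 :=
      mul_le_mul_of_nonneg_left hE (by positivity)
    nlinarith [mul_nonneg (sub_nonneg.2 hy) (sub_nonneg.2 h4)]
  · have hE : Real.exp (0.138 * (1 + y)) ≤ 2.19 :=
      (Real.exp_le_exp.2 (by nlinarith)).trans exp_07797_le
    have h' : (1 + y) ^ 2 * Real.exp (0.138 * (1 + y)) ≤ (1 + y) ^ 2 * 2.19 :=
      mul_le_mul_of_nonneg_left hE (by positivity)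
    nlinarith [mul_nonneg (sub_nonneg.2 (not_le.1 h4).le) (sub_nonneg.2 h465)]

/-! ### (17): the given odd character is the Kronecker character; `L(1,χ′) = π h₀/√q′` -/

/-- Two odd primitive quadratic characters of the same modulus `M > 1` are equal: both are the Kronecker
character `χ_{−M}` moved to level `M` (`changeLevel_kroneckerChar_eq`).
[cite: MontgomeryVaughan2007, Theorem 9.13] -/
theorem eq_of_isPrimitive_isQuadratic_odd {M : ℕ} [NeZero M] (hM : 1 < M) {χ₁ χ₂ : DirichletCharacter ℂ M}
    (h1p : χ₁.IsPrimitive) (h1q : χ₁.IsQuadratic) (h1o : χ₁.Odd)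
    (h2p : χ₂.IsPrimitive) (h2q : χ₂.IsQuadratic) (h2o : χ₂.Odd) : χ₁ = χ₂ := by
  obtain ⟨s, hpar, -, hfd, hDq⟩ := Zhang2022.Repair.Bed.Vacuity.exists_sign_fundamental h1p h1q hM
  have hs1 : s = -1 := by
    rcases hpar with ⟨-, hev⟩ | ⟨h, -⟩
    · exfalso
      have h1 : χ₁ (-1) = 1 := hev
      have h2 : χ₁ (-1) = -1 := h1o
      rw [h1] at h2
      norm_num at h2
    · exact h
  subst hs1
  haveI : NeZero ((-1 : ℤ) * (M : ℤ)).natAbs := ⟨by rw [hDq]; exact NeZero.ne M⟩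
  have hdvd : ((-1 : ℤ) * (M : ℤ)).natAbs ∣ M := by rw [hDq]
  have e1 := Zhang2022.Repair.Bed.Vacuity.changeLevel_kroneckerChar_eq h1p h1q (Or.inr ⟨rfl, h1o⟩) hfd
    hdvd hDq
  have e2 := Zhang2022.Repair.Bed.Vacuity.changeLevel_kroneckerChar_eq h2p h2q (Or.inr ⟨rfl, h2o⟩) hfd
    hdvd hDq
  rw [← e1, ← e2]

/-- **(17), p. 173: `L(1, χ′) = π h₀/√|d′|`** for the odd real primitive character `χ′` mod `|d_K|` of an
imaginary quadratic field `K` with `d_K < −4` (`w_K = 2`), `h₀ = h_K`: the Kronecker character `κ` of `K`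
(odd `d_K`: the Jacobi character; even: `Quadratic.exists_kroneckerChar_of_four_dvd`) has `ζ_K = ζ L(κ)` and
`L(1,κ) = 2π h_K/(w_K √|d_K|)` (`Quadratic.LFunction_one_eq_of_discr_neg_of_eq`), and `χ′ = κ`
(`eq_of_isPrimitive_isQuadratic_odd`). [cite: Hoffstein1980SiegelTatuzawa, (17) p. 173]
[cite: NeukirchANT1999, Ch. VII §5 (5.11)] -/
theorem LFunction_one_eq_pi_mul_classNumber_div_sqrt {K : Type*} [Field K] [NumberField K]
    (h2 : Module.finrank ℚ K = 2) (hd4 : NumberField.discr K < -4) {q' : ℕ} [NeZero q']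
    (hq' : (NumberField.discr K).natAbs = q') (χ' : DirichletCharacter ℂ q')
    (hp : χ'.IsPrimitive) (hq : χ'.IsQuadratic) (ho : χ'.Odd) :
    χ'.LFunction 1 = ((Real.pi * NumberField.classNumber K / Real.sqrt (q' : ℝ) : ℝ) : ℂ) := by
  subst hq'
  classical
  have hneg : NumberField.discr K < 0 := by omega
  obtain ⟨κ, hκp, hκq, hκ1, hκo, hfac⟩ : ∃ κ : DirichletCharacter ℂ (NumberField.discr K).natAbs,
      κ.IsPrimitive ∧ κ.IsQuadratic ∧ κ ≠ 1 ∧ κ.Odd ∧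
      ∀ s : ℂ, 1 < s.re → NumberField.dedekindZeta K s = riemannZeta s * LSeries (fun n ↦ κ n) s := by
    rcases isFundamentalDiscriminant_discr (K := K) h2 with ⟨h1, hsqf, -⟩ | ⟨h4, -, -⟩
    · -- odd discriminant `d ≡ 1 (mod 4)`, `d < 0`, so `|d| ≡ 3 (mod 4)`
      have hodd : Odd (NumberField.discr K) := by rw [Int.odd_iff]; omega
      have hoddN : Odd (NumberField.discr K).natAbs := Int.natAbs_odd.mpr hodd
      have hsqN : Squarefree (NumberField.discr K).natAbs := Int.squarefree_natAbs.mpr hsqf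
      have hmod : (NumberField.discr K).natAbs % 4 = 3 := by
        have : ((NumberField.discr K).natAbs : ℤ) = -NumberField.discr K :=
          Int.ofNat_natAbs_of_nonpos hneg.le
        omega
      have hoddκ : (jacobiChar (NumberField.discr K).natAbs).Odd := by
        show jacobiChar (NumberField.discr K).natAbs (-1) = -1
        have h := jacobiChar_intCast (q := (NumberField.discr K).natAbs) (-1)
        rw [Int.cast_neg, Int.cast_one] at h
        rw [h, jacobiSym.at_neg_one hoddN, ZMod.χ₄_nat_three_mod_four hmod, Int.cast_neg, Int.cast_one]
      exact ⟨jacobiChar (NumberField.discr K).natAbs, isPrimitive_jacobiChar hoddN hsqN,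
        fun a ↦ jacobiChar_trichotomy a, jacobiChar_natAbs_discr_ne_one h2 hodd, hoddκ,
        fun s hs ↦ dedekindZeta_eq_riemannZeta_mul_LSeries h2 hodd hs⟩
    · -- even discriminant
      obtain ⟨κ, hprim, hquad, hne, -, -, hod, hfac⟩ := exists_kroneckerChar_of_four_dvd h2 h4
      exact ⟨κ, hprim, hquad, hne, hod hneg, hfac⟩
  have hM1 : 1 < (NumberField.discr K).natAbs := by omega
  have hκχ : κ = χ' := eq_of_isPrimitive_isQuadratic_odd hM1 hκp hκq hκo hp hq ho
  have hcnf := LFunction_one_eq_of_discr_neg_of_eq h2 hneg hκ1 (fun s hs ↦ hfac s (by simpa using hs))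
  have hw : (NumberField.Units.torsionOrder K : ℝ) = 2 := by
    exact_mod_cast torsionOrder_eq_two_of_discr_lt_neg_four h2 hd4
  have habs : |(NumberField.discr K : ℝ)| = ((NumberField.discr K).natAbs : ℝ) := by
    rw [← Int.cast_abs, Int.abs_eq_natAbs, Int.cast_natCast]
  rw [← hκχ, hcnf, hw, habs, mul_assoc (2 : ℝ), mul_div_mul_left _ _ (two_ne_zero)]

/-! ### The §3 core (from the proof of Theorem 1′) -/

section Core

variable {q q' : ℕ} [NeZero q] [NeZero q']

/-- **The §3 core, (7)–(11) + (14), as extracted from the proof of Theorem 1′** (`theorem1'_of_le`): for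
`χ ≠ χ′` real primitive mod `q ≥ q′ > 10⁶` and a real zero `β′ ∈ [1 − 1/(11.657 log q′), 1)` of `L(s,χ′)`,
`1.6 (1 − β′) x^{−(1−β′)} ≤ L(1,χ) · L(1,χ′) · (½ log qq′ + 1.3)`, `x = (qq′)^{3/2}` (the master inequality
`hoffstein_master3` for `ζ L_χ L_χ′ L_ψ`, `ψ` the primitive inducer of `χχ′`, with `L(1,ψ) ≤ ½ log k + 1.3`,
`k ≤ qq′`; print: (11) `0.981(1−β′) ≤ L(1,χ)L(1,χ′)L(1,χχ′) x^{1−β′}` and (14) `L(1,χχ′) < .589 log|dd′|`).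
[cite: Hoffstein1980SiegelTatuzawa, §3 (7)–(11), (14) pp. 170–172] -/
theorem core3 (χ : DirichletCharacter ℂ q) (χ' : DirichletCharacter ℂ q') (hχp : χ.IsPrimitive)
    (hχq : χ.IsQuadratic) (hχ1 : χ ≠ 1) (hχ'p : χ'.IsPrimitive) (hχ'q : χ'.IsQuadratic) (hχ'1 : χ' ≠ 1)
    (hne : (fun n : ℕ ↦ χ n) ≠ fun n : ℕ ↦ χ' n) (hq'6 : (10 ^ 6 : ℝ) < q') (hqq' : q' ≤ q)
    {β : ℝ} (hz : χ'.LFunction β = 0) (hβlo : 1 - 1 / (11.657 * Real.log q') ≤ β) (hβ1 : β < 1) :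
    1.6 * (1 - β) * (((q : ℝ) * q') ^ (3 / 2 : ℝ)) ^ (-(1 - β)) ≤
      (χ.LFunction 1).re * ((χ'.LFunction 1).re * (Real.log ((q : ℝ) * q') / 2 + 1.3)) := by
  -- basic sizes
  have hq'r : (10 ^ 6 : ℝ) < q' := hq'6
  have hqq'r : (q' : ℝ) ≤ q := by exact_mod_cast hqq'
  have hqr : (10 ^ 6 : ℝ) < q := lt_of_lt_of_le hq'r hqq'r
  have hq1 : 1 < q := by exact_mod_cast (lt_trans (by norm_num : (1:ℝ) < 10 ^ 6) hqr)
  have hq'1 : 1 < q' := by exact_mod_cast (lt_trans (by norm_num : (1:ℝ) < 10 ^ 6) hq'r)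
  have hq0 : (0 : ℝ) < q := by linarith only [hqr]
  have hq'0 : (0 : ℝ) < q' := by linarith only [hq'r]
  have hlq' := log_gt_of_gt_ten6' hq'r
  have hlq := log_gt_of_gt_ten6' hqr
  have hlq'0 : 0 < Real.log q' := by linarith only [hlq']
  have hlq0 : 0 < Real.log q := by linarith only [hlq]
  set N : ℝ := (q : ℝ) * q' with hN
  have hN0 : 0 < N := by positivity
  have hN12 : (10 : ℝ) ^ 12 ≤ N := by
    rw [hN]
    calc (10 : ℝ) ^ 12 = 10 ^ 6 * 10 ^ 6 := by norm_num
      _ ≤ (q : ℝ) * q' := mul_le_mul (hq'r.le.trans hqq'r) hq'r.le (by norm_num) hq0.le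
  have hN1 : (1 : ℝ) ≤ N := le_trans (by norm_num) hN12
  have hlN : Real.log N = Real.log q + Real.log q' := by rw [hN, Real.log_mul hq0.ne' hq'0.ne']
  have hlN26 : (26 : ℝ) < Real.log N := by rw [hlN]; linarith only [hlq, hlq']
  have hlN0 : 0 < Real.log N := by linarith only [hlN26]
  have h2 : χ ^ 2 = 1 := hχq.sq_eq_one
  have h2' : χ' ^ 2 = 1 := hχ'q.sq_eq_one
  -- `L(1,χ) > 0`, `L(1,χ′) > 0`
  obtain ⟨hLpos, -⟩ := LFunction_one_re_pos' hχ1 h2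
  obtain ⟨hL'pos, -⟩ := LFunction_one_re_pos' hχ'1 h2'
  have hκ0 : 0 < 1 - β := by linarith only [hβ1]
  have hκ : 1 - β ≤ 1 / (11.657 * Real.log q') := by linarith only [hβlo]
  have hκ' : (1 - β) * Real.log q' ≤ 1 / 11.657 := by
    rw [le_div_iff₀ (by positivity)] at hκ; rw [le_div_iff₀ (by norm_num)]; linarith only [hκ]
  have hκ1 : 1 - β < 0.0066 := by
    have h3 : (1 - β) * 13.1697 ≤ (1 - β) * Real.log q' := mul_le_mul_of_nonneg_left hlq'.le hκ0.le
    have : (1 / 11.657 : ℝ) < 0.0066 * 13.1697 := by norm_num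
    nlinarith only [h3, hκ', this, hκ0]
  have hβ0 : 1 / 2 < β := by linarith only [hκ1]
  -- the third character `ψ`
  obtain ⟨k, hkI, ψ, hk1, hkdvd, hψp, hψ2, hψ1, hlink, -⟩ :=
    exists_primitive_inducer χ χ' hχp hχ'p h2 h2' hne
  obtain ⟨hLψpos, hLψnorm⟩ := LFunction_one_re_pos' hψ1 hψ2
  have hkle : (k : ℝ) ≤ N := by
    rw [hN]
    exact_mod_cast Nat.le_of_dvd (Nat.pos_of_ne_zero (mul_ne_zero (NeZero.ne q) (NeZero.ne q'))) hkdvd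
  have hk0 : (0 : ℝ) < k := by exact_mod_cast (zero_lt_one.trans hk1)
  -- (14): `L(1,ψ) ≤ ½ log k + 1.3 ≤ ½ log N + 1.3 =: u`
  set u : ℝ := Real.log N / 2 + 1.3 with hu
  have hLψle : (ψ.LFunction 1).re ≤ u := by
    have h := Louboutin2001.norm_LFunction_one_le_of_isPrimitive (χ := ψ) hψp hψ1
    rw [hLψnorm] at h
    have : Real.log k ≤ Real.log N := Real.log_le_log hk0 hkle
    rw [hu]; linarith only [h, this]
  have hu0 : 0 < u := by rw [hu]; positivity
  -- the choice `x = N^{3/2}`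
  set x : ℝ := N ^ (3 / 2 : ℝ) with hxdef
  have hx0 : 0 < x := Real.rpow_pos_of_pos hN0 _
  have hxN : N ≤ x := by
    rw [hxdef]
    calc N = N ^ (1 : ℝ) := (Real.rpow_one N).symm
      _ ≤ N ^ (3 / 2 : ℝ) := Real.rpow_le_rpow_of_exponent_le hN1 (by norm_num)
  have hx4 : (40000 : ℝ) ≤ x := le_trans (by linarith only [hN12]) hxN
  -- the master inequality
  have hFβ : hoffF χ χ' ψ β = 0 := hoffF_eq_zero_of_LFunction_eq_zero hz
  have hM := hoffstein_master3 hq1 hq'1 hk1 hχp hχ'p hψp h2 h2' hψ2 hlink hβ0 hβ1 hFβ hx4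
  -- numerics (a): the squares sum
  have hSm := sum200_ge (le_trans (le_trans (by norm_num) hN12) hxN)
  -- numerics (b): the error term `C₃ x^{-3/2} ≤ 3.9 N² N^{-9/4} = 3.9 N^{-1/4}`
  have hx32 : x ^ (-(3 / 2 : ℝ)) = N ^ (-(9 / 4 : ℝ)) := by
    rw [hxdef, ← Real.rpow_mul hN0.le]; norm_num
  have hE : hoffErr3 q q' k * x ^ (-(3 / 2 : ℝ)) ≤ 3.9 * N ^ (-(1 / 4 : ℝ)) := by
    rw [hoffErr3, hx32]
    have hqqk : (q : ℝ) * q' * k ≤ N * N := by rw [hN]; gcongr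
    have hNN : N * N * N ^ (-(9 / 4 : ℝ)) = N ^ (-(1 / 4 : ℝ)) := by
      rw [show N * N = N ^ (2 : ℝ) by rw [Real.rpow_two]; ring, ← Real.rpow_add hN0]; norm_num
    have hZ0 : 0 ≤ bigZ (3 / 2) := (bigZ_pos (by norm_num)).le
    calc 720 * ((q : ℝ) * q' * k) * bigZ (3 / 2) ^ 4 / (7 * (2 * π) ^ 4) * N ^ (-(9 / 4 : ℝ))
        = (720 * bigZ (3 / 2) ^ 4 / (7 * (2 * π) ^ 4)) * (((q : ℝ) * q' * k) * N ^ (-(9 / 4 : ℝ))) := by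
          ring
      _ ≤ 3.9 * ((N * N) * N ^ (-(9 / 4 : ℝ))) := by gcongr; exact errConst3_le
      _ = 3.9 * N ^ (-(1 / 4 : ℝ)) := by rw [hNN]
  --   `x^{1−β} = N^{1.5(1−β)} ≤ N^{1/100}` and `N^{1/100 − 1/4} ≤ N^{−1/5} ≤ 1/100`
  have hxκ_le : x ^ (1 - β) ≤ N ^ (1 / 100 : ℝ) := by
    rw [hxdef, ← Real.rpow_mul hN0.le]
    exact Real.rpow_le_rpow_of_exponent_le hN1 (by linarith only [hκ1])
  have hN5 : N ^ (-(1 / 5 : ℝ)) ≤ 1 / 100 := by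
    have h := rpow_fifth_ge (N := N) (le_trans (by norm_num) hN12)
    rw [Real.rpow_neg hN0.le]
    exact (inv_le_inv₀ (by positivity) (by norm_num)).2 h |>.trans (by norm_num)
  have hEx : hoffErr3 q q' k * x ^ (-(3 / 2 : ℝ)) * x ^ (1 - β) ≤ 0.039 := by
    have h1 : hoffErr3 q q' k * x ^ (-(3 / 2 : ℝ)) * x ^ (1 - β) ≤
        3.9 * N ^ (-(1 / 4 : ℝ)) * N ^ (1 / 100 : ℝ) :=
      mul_le_mul hE hxκ_le (Real.rpow_pos_of_pos hx0 _).le (by positivity)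
    have h2 : N ^ (-(1 / 4 : ℝ)) * N ^ (1 / 100 : ℝ) ≤ N ^ (-(1 / 5 : ℝ)) := by
      rw [← Real.rpow_add hN0]
      exact Real.rpow_le_rpow_of_exponent_le hN1 (by norm_num)
    calc hoffErr3 q q' k * x ^ (-(3 / 2 : ℝ)) * x ^ (1 - β)
        ≤ 3.9 * (N ^ (-(1 / 4 : ℝ)) * N ^ (1 / 100 : ℝ)) := by rw [← mul_assoc]; exact h1
      _ ≤ 3.9 * N ^ (-(1 / 5 : ℝ)) := by gcongr
      _ ≤ 3.9 * (1 / 100) := by gcongr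
      _ = 0.039 := by norm_num
  -- from the master inequality to `1.6 (1−β) x^{−(1−β)} ≤ L(1,χ) L(1,χ′) L(1,ψ)`
  set Sm : ℝ := ∑ m ∈ Finset.range 200, (1 / ((m : ℝ) + 1) ^ 2 - 15 * ((m : ℝ) + 1) ^ 2 / x ^ 2)
    with hSmdef
  set P : ℝ := (χ.LFunction 1).re * ((χ'.LFunction 1).re * (ψ.LFunction 1).re) with hP
  set E : ℝ := hoffErr3 q q' k * x ^ (-(3 / 2 : ℝ)) with hEdef
  have hxκ0 : 0 < x ^ (-(1 - β)) := Real.rpow_pos_of_pos hx0 _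
  have hxinv : x ^ (-(1 - β)) * x ^ (1 - β) = 1 := by rw [← Real.rpow_add hx0]; simp
  have hA : 1.6 * (1 - β) * x ^ (-(1 - β)) ≤ P := by
    have h1 : x ^ (-(1 - β)) * Sm - E = x ^ (-(1 - β)) * (Sm - E * x ^ (1 - β)) := by
      have : E = x ^ (-(1 - β)) * (E * x ^ (1 - β)) := by
        rw [show x ^ (-(1 - β)) * (E * x ^ (1 - β)) = E * (x ^ (-(1 - β)) * x ^ (1 - β)) by ring,
          hxinv, mul_one]
      conv_lhs => rw [this]
      ring
    rw [h1] at hM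
    have h2 : (1.6 : ℝ) ≤ Sm - E * x ^ (1 - β) := by linarith only [hSm, hEx]
    calc 1.6 * (1 - β) * x ^ (-(1 - β)) = (1 - β) * (x ^ (-(1 - β)) * 1.6) := by ring
      _ ≤ (1 - β) * (x ^ (-(1 - β)) * (Sm - E * x ^ (1 - β))) := by gcongr
      _ ≤ P := hM
  calc 1.6 * (1 - β) * x ^ (-(1 - β)) ≤ P := hA
    _ ≤ (χ.LFunction 1).re * ((χ'.LFunction 1).re * u) := by rw [hP]; gcongr

end Core

end Literature.NumberTheory.LFunctions.Hoffstein1980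

namespace Literature.NumberTheory.LFunctions

open Hoffstein1980 Literature.NumberTheory.QuadraticFields.Quadratic

/-- **Hoffstein 1980, Theorem 2 (p. 168; typed per §4 p. 173) — DISCHARGED.** "Let `ε > 0` and `d′`,
`|d′| > ε⁻²`, be an exceptional discriminant … `d′ < 0` with class number `h₀`. For any other discriminant
`d` … `L(1, χ) > min[1/(7.735 log|d|), ε⁻¹/(15.350 h₀ (log|d|)² |d|^{3.344 h₀ ε})]`." Proof: §4 p. 173 as
described in the module docstring ((17) class number formula, Lemma 1, (18), the §3 core, Lemma 3, and the
`y > 4.63` reduction via Theorem 1′). [cite: Hoffstein1980SiegelTatuzawa, Theorem 2 p. 168, §4 p. 173] -/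
theorem hoffstein1980_theorem2_holds : hoffstein1980_theorem2 := by
  intro ε hε hε1 q' _ χ' hχ'p hχ'q hχ'o hq'ε hL' K' _ _ h2 hd q _ χ hχp hχq hχ1 hne hqq'
  -- sizes
  have h1000 : (1000 : ℝ) < ε⁻¹ := by rw [lt_inv_comm₀ (by norm_num) hε, ← one_div]; exact hε1
  have hε2 : (10 ^ 6 : ℝ) < ε⁻¹ ^ 2 := by
    rw [show (10 ^ 6 : ℝ) = 1000 ^ 2 by norm_num]
    exact pow_lt_pow_left₀ h1000 (by norm_num) two_ne_zero
  have hq'6 : (10 ^ 6 : ℝ) < q' := hε2.trans hq'ε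
  have hq'1r : (1 : ℝ) < q' := lt_trans (by norm_num) hq'6
  have hq'1 : 1 < q' := by exact_mod_cast hq'1r
  have hq'0 : (0 : ℝ) < q' := by linarith only [hq'1r]
  have hqq'r : (q' : ℝ) ≤ q := by exact_mod_cast hqq'
  have hq0 : (0 : ℝ) < q := by linarith only [hq'1r, hqq'r]
  have hq1r : (1 : ℝ) < q := by linarith only [hq'1r, hqq'r]
  have hχ'1 : χ' ≠ 1 := ne_one_of_isPrimitive₄ hχ'p hq'1
  have hlq' := log_gt_of_gt_ten6' hq'6
  have hlq := log_gt_of_gt_ten6' (lt_of_lt_of_le hq'6 hqq'r)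
  have hlq'0 : 0 < Real.log q' := by linarith only [hlq']
  have hlq0 : 0 < Real.log q := by linarith only [hlq]
  have hlqq' : Real.log q' ≤ Real.log q := Real.log_le_log hq'0 hqq'r
  have hlN : Real.log ((q : ℝ) * q') = Real.log q + Real.log q' := Real.log_mul hq0.ne' hq'0.ne'
  -- `√q′ > ε⁻¹`
  set r : ℝ := Real.sqrt q' with hrdef
  have hr : ε⁻¹ < r := by rw [hrdef, Real.lt_sqrt (by positivity)]; exact hq'ε
  have hr0 : 0 < r := lt_trans (by positivity) hr
  have h1r : 1 / r ≤ ε := by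
    rw [div_le_iff₀ hr0, mul_comm]
    have : ε⁻¹ * ε ≤ r * ε := mul_le_mul_of_nonneg_right hr.le hε.le
    rwa [inv_mul_cancel₀ hε.ne'] at this
  -- (17): `L(1,χ′) = π h₀/√q′`
  have hnat : (NumberField.discr K').natAbs = q' := by rw [hd]; simp
  have hq'4 : 4 < q' := by exact_mod_cast (show (4 : ℝ) < q' by linarith only [hq'6])
  have hd4 : NumberField.discr K' < -4 := by rw [hd]; omega
  set h : ℝ := (NumberField.classNumber K' : ℝ) with hh
  have hh0 : 0 < h := by rw [hh]; exact_mod_cast NumberField.classNumber_pos (K := K')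
  have hLcnf := LFunction_one_eq_pi_mul_classNumber_div_sqrt h2 hd4 hnat χ' hχ'p hχ'q hχ'o
  have hL're : (χ'.LFunction 1).re = Real.pi * h / r := by rw [hLcnf, Complex.ofReal_re]
  -- Lemma 1 / (5) ⇒ (6): the zero `β′` with `1.511 (1 − β′) < L(1,χ′)`
  obtain ⟨β, hz, hβlo, hβ1, -, hL1⟩ := exists_realZero_of_lOne_le hχ'p hχ'q hq'6.le hL'.le
  have hκ0 : 0 < 1 - β := by linarith only [hβ1]
  have hκ' : (1 - β) * Real.log q' ≤ 1 / 11.657 := by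
    have hκ : 1 - β ≤ 1 / (11.657 * Real.log q') := by linarith only [hβlo]
    rw [le_div_iff₀ (by positivity)] at hκ; rw [le_div_iff₀ (by norm_num)]; linarith only [hκ]
  -- Lemma 3
  rcases hoffstein1980_lemma3_holds q χ _ χ' hχp hχq hχ1 hχ'p hχ'q hχ'1 hne hq'6.le hqq' β hβ1 hz
    with h16 | hdone
  swap
  · exact lt_of_le_of_lt (min_le_left _ _) hdone
  -- Theorem 1′ read backwards: either done, or `y = log q/log q′ > 4.65`
  by_cases hL : 1 / (7.735 * Real.log q) < (χ.LFunction 1).re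
  · exact lt_of_le_of_lt (min_le_left _ _) hL
  push Not at hL
  have h1' := theorem1'_of_le χ χ' hχp hχq hχ1 hχ'p hχ'q hχ'1 hne hq'6 hqq' hL'.le
  have hTa := lt_of_lt_of_le ((min_lt_iff.mp h1').resolve_left (not_lt.mpr hL)) hL
  obtain ⟨y, hydef⟩ : ∃ y : ℝ, y = Real.log q / Real.log q' := ⟨_, rfl⟩
  have hLq : Real.log q = y * Real.log q' := by rw [hydef]; field_simp
  have hy1 : 1 ≤ y := by rw [hydef, le_div_iff₀ hlq'0, one_mul]; exact hlqq'
  have hy0 : 0 < y := lt_of_lt_of_le one_pos hy1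
  have hE : ((q : ℝ) * q') ^ (0.138 / Real.log q') = Real.exp (0.138 * (1 + y)) := by
    rw [Real.rpow_def_of_pos (by positivity), hlN, hLq]
    congr 1
    field_simp
    ring
  have h1y : 1 + Real.log q / Real.log q' = 1 + y := by rw [hydef]
  rw [hE, h1y, hLq, div_lt_div_iff₀ (by positivity) (by positivity), one_mul, one_mul] at hTa
  have hC : 15.47 * y < (1 + y) ^ 2 * Real.exp (0.138 * (1 + y)) := by
    have h2 : Real.log q' * (15.47 * y) < Real.log q' * ((1 + y) ^ 2 * Real.exp (0.138 * (1 + y))) := by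
      linarith [hTa]
    exact lt_of_mul_lt_mul_left h2 hlq'0.le
  have hy465 := lt_of_constraint hy1 hC
  have hlNle : Real.log ((q : ℝ) * q') ≤ 1.2151 * Real.log q := by
    rw [hlN, hLq]
    have : 4.65 * Real.log q' < y * Real.log q' := mul_lt_mul_of_pos_right hy465 hlq'0
    nlinarith only [this, hlq'0, hy0]
  have hlN0 : 0 < Real.log ((q : ℝ) * q') := by rw [hlN]; positivity
  have hlN26 : (26 : ℝ) < Real.log ((q : ℝ) * q') := by rw [hlN]; linarith only [hlq, hlq']
  -- the §3 core
  have hcore := core3 χ χ' hχp hχq hχ1 hχ'p hχ'q hχ'1 hne hq'6 hqq' hz hβlo hβ1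
  rw [hL're] at hcore hL1
  have hule : Real.log ((q : ℝ) * q') / 2 + 1.3 ≤ 0.6684 * Real.log q := by
    linarith only [hlNle, hlN26, hlq]
  -- (18): `x^{−(1−β′)} ≥ 0.878 · q^{−3.344 h ε}`
  set Q : ℝ := (q : ℝ) ^ (3.344 * h * ε) with hQ
  have hQ0 : 0 < Q := Real.rpow_pos_of_pos hq0 _
  have hexp : 3 / 2 * (1 - β) ≤ 3.344 * h * ε := by
    have h2 : Real.pi * h / r ≤ Real.pi * h * ε := by
      rw [div_eq_mul_one_div]
      exact mul_le_mul_of_nonneg_left h1r (by positivity)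
    have h3 : Real.pi * h * ε ≤ 3.1416 * h * ε := by
      have := Real.pi_lt_d4
      have hhe : 0 ≤ h * ε := by positivity
      nlinarith only [this, hhe]
    have hhe : 0 ≤ h * ε := by positivity
    linarith only [hL1, h2, h3, hκ0, hhe]
  have hxlow : 0.878 * Q⁻¹ ≤ (((q : ℝ) * q') ^ (3 / 2 : ℝ)) ^ (-(1 - β)) := by
    rw [← Real.rpow_mul (by positivity), Real.mul_rpow hq0.le hq'0.le]
    have hqt : Q⁻¹ ≤ (q : ℝ) ^ (3 / 2 * -(1 - β)) := by
      rw [hQ, ← Real.rpow_neg hq0.le]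
      exact Real.rpow_le_rpow_of_exponent_le hq1r.le (by linarith only [hexp])
    have hq't : (0.878 : ℝ) ≤ (q' : ℝ) ^ (3 / 2 * -(1 - β)) := by
      rw [Real.rpow_def_of_pos hq'0]
      have h1 : -0.1287 ≤ Real.log q' * (3 / 2 * -(1 - β)) := by nlinarith only [hκ']
      have h2 : Real.exp (-0.1287) ≤ Real.exp (Real.log q' * (3 / 2 * -(1 - β))) := Real.exp_le_exp.2 h1
      refine le_trans ?_ h2
      rw [Real.exp_neg, le_inv_comm₀ (by norm_num) (Real.exp_pos _)]
      exact exp_01287_le.trans (by norm_num)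
    calc 0.878 * Q⁻¹ = Q⁻¹ * 0.878 := mul_comm _ _
      _ ≤ (q : ℝ) ^ (3 / 2 * -(1 - β)) * (q' : ℝ) ^ (3 / 2 * -(1 - β)) :=
          mul_le_mul hqt hq't (by norm_num) (Real.rpow_nonneg hq0.le _)
  -- the two sides over the common denominator `log q · Q`
  have hA : 0.198 / (Real.log q * Q) < 1.6 * (1 - β) * (((q : ℝ) * q') ^ (3 / 2 : ℝ)) ^ (-(1 - β)) := by
    have e2 : 1.6 * (1 / (5.828 * (1.2151 * Real.log q))) * (0.878 * Q⁻¹) =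
        (1.6 * 0.878 / (5.828 * 1.2151)) / (Real.log q * Q) := by
      field_simp
    have h16' : 1 / (5.828 * (1.2151 * Real.log q)) ≤ 1 - β := by
      refine le_trans ?_ h16.le
      exact one_div_le_one_div_of_le (mul_pos (by norm_num) hlN0) (by nlinarith only [hlNle])
    calc 0.198 / (Real.log q * Q) ≤ (1.6 * 0.878 / (5.828 * 1.2151)) / (Real.log q * Q) :=
          div_le_div_of_nonneg_right (by norm_num) (by positivity)
      _ = 1.6 * (1 / (5.828 * (1.2151 * Real.log q))) * (0.878 * Q⁻¹) := e2.symm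
      _ ≤ 1.6 * (1 / (5.828 * Real.log ((q : ℝ) * q'))) * (0.878 * Q⁻¹) := by gcongr
      _ < 1.6 * (1 - β) * (0.878 * Q⁻¹) := by gcongr
      _ ≤ 1.6 * (1 - β) * (((q : ℝ) * q') ^ (3 / 2 : ℝ)) ^ (-(1 - β)) := by gcongr
  -- `B · v ≤ 0.137/(log q · Q)` where `v = L(1,χ′) · u`
  set B : ℝ := ε⁻¹ / (15.350 * h * Real.log q ^ 2 * Q) with hBdef
  set u : ℝ := Real.log ((q : ℝ) * q') / 2 + 1.3 with hu
  set v : ℝ := Real.pi * h / r * u with hv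
  have hv0 : 0 < v := by positivity
  have hB0 : 0 ≤ B := by positivity
  have hvle : v ≤ Real.pi * h * ε * (0.6684 * Real.log q) := by
    rw [hv, div_eq_mul_one_div]
    gcongr
  have hBv : B * v ≤ 0.137 / (Real.log q * Q) := by
    have e : B * (Real.pi * h * ε * (0.6684 * Real.log q)) =
        (Real.pi * 0.6684 / 15.350) / (Real.log q * Q) := by
      rw [hBdef]
      field_simp
    have hπ := Real.pi_lt_d4
    calc B * v ≤ B * (Real.pi * h * ε * (0.6684 * Real.log q)) := mul_le_mul_of_nonneg_left hvle hB0
      _ = (Real.pi * 0.6684 / 15.350) / (Real.log q * Q) := e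
      _ ≤ 0.137 / (Real.log q * Q) := by
          have hnum : Real.pi * 0.6684 / 15.350 ≤ 0.137 := by
            rw [div_le_iff₀ (by norm_num)]; nlinarith only [hπ]
          exact div_le_div_of_nonneg_right hnum (by positivity)
  refine lt_of_le_of_lt (min_le_right _ _) ?_
  have hmid : 0.137 / (Real.log q * Q) < 0.198 / (Real.log q * Q) :=
    div_lt_div_of_pos_right (by norm_num) (by positivity)
  have hchain : B * v < (χ.LFunction 1).re * v := by linarith only [hBv, hmid, hA, hcore]
  exact lt_of_mul_lt_mul_right hchain hv0.le

end Literature.NumberTheory.LFunctions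

end
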